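import Summits.ABC.IUTFork.Repair.RHReachLedgerDoor
import Summits.ABC.IUTFork.Repair.RH2SigmaHull
import Summits.ABC.IUTFork.Cor312PilotIdelesPrCapstone
import HarnessLib

/-!
# R-H ROUND 2, row 27 «reach-ledger» (3/3) — THE ROW-27 DOOR AT THE GENUINE BED `Cor312Prov.pilotDataOfK D K` with REALISING ideles:
# the setting's binders DISCHARGED (`BridgeHyps`, norm uniformizers, Θ/q-orders); left: uniform fibres, the two certificates, the ledger

PROOF-ONLY file (0 definitions, 0 `Prop` facts; abc-iut cell, D-0079 RESCUE sub-cell R-H, rung LADDER-ABC:A2.RESCUE.H; ROUND-2 seat abc-iut-rh2-L1,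
row 27's (α)/(β) seat; companions `Repair/RHReachLedgerRealise.lean` (p475227, (α)) and `Repair/RHReachLedgerDoor.lean` (p475842, the door
`statement_of_hStarReachLedger` for an abstract pilot datum)). TAKES NO SIDE on [IUTchIII] Cor. 3.12 or on any author; abc-iut-lens-nearmiss-1's
`HStarReachLedgerK` (p464022) is an R-H CANDIDATE = a HYPOTHESIS SHAPE, never asserted; typed ≠ proved; instantiated ≠ endorsed; nothing here asserts
abc proved or refuted. Pattern and inputs BY NAME: abc-iut-rh2-q2-hull's row-15 genuine-bed discharge `Repair/RH2SigmaHull.lean` §2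
(`exists_normUniformizers`, `norm_qIdele_eq_zpow_of_realises`, `norm_thetaIdele_eq_zpow_of_realises`, `zpow_of_norm_eq_rpow`), abc-iut-c312-7's
`bridgeHyps_settingPrVolSharp_of_ideles` (every `BridgeHyps` field a theorem for idele-read sharp boxes), campaign-S `ramIdx_eq`.

WHAT IS PROVED. **`statement_pilotDataOfK_of_hStarReachLedgerK`** — at the genuine `K`-level datum `pilotDataOfK D K` ([IUTchI] Ex. 3.2 (iv)) with Θ-
and q-ideles REALISING the pilot divisors (log-form `ht`/`htq`, nonzero, units off `S` — branch C's side conditions, inhabited by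
`Cor312Prov.exists_realising_{theta,q}Ideles_pilotDataOfK`): IF the fibres of `K` over every prime are UNIFORM (`e(x∣p) = e_p` for all `x ∣ p` — the
`K/ℚ` Galois rows: HEX, G-HEX, lamSeven, frey), the datum carries per prime an INNER certificate `A_p` (one non-log-unit of norm `≤ p^{−(A_p−1)/e_p}` at
every `x ∣ p`) and an OUTER certificate `B_p` (one log-unit of norm `≥ p^{−B_p/e_p}`) DOMINATING the ledger's columns (`innerCond p e_p ≤ A_p`,
`B_p ≤ rOutSharp p e_p`), and the integer Kummer orders `m_q(w) = P_q(w)` at the bad places, THEN row 27's candidate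
`HStarReachLedgerK D e m_q` (intrinsic index `e(x) = e(𝔭_x ∣ p)`) implies the typed [IUTchIII] Cor. 3.12 `Statement` of
`settingPrVolSharp (pilotDataOfK D K) … tq t …` — ANY columns/context data. The remaining binders are exactly: uniformity, the two certificates
(for `(A, B) = (innerCond, rOutSharp)`: row 20's `RH.LinearReachLaw.isInnerConductor_of_not_dvd` off the inner ties, `RHSlotReach.exists_hrad_sharp`
off the outer ties — NOT supplied here), and the ledger itself. «Statement follows from the ledger AS TYPED + certificates»; which data satisfy the
ledger is rh-num-1's table. [cite: DupuyHilado2025, §3.3, §3.4, §3.6, §3.9, §4.9] [cite: NeukirchANT1999, Ch. II Prop. (6.8)]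
[cite: Mochizuki2012, IUTchI Ex. 3.2 (iv) p. 71; IUTchIII Rmk. 3.9.3 pp. 119–120, Cor. 3.12 p. 173–174] [claim: Mochizuki2012, status: disputed]
-/

noncomputable section

open Set Function
open scoped Pointwise

namespace Summit.ABC.IUTFork.Repair.RH.ReachLedgerDoor

open Thm311 Thm311.Real Cor312 Cor312.Setting Cor312Vol Cor312Prov Literature.IUT.LogThetaLattice Literature.IUT.LogVolume
  Literature.IUT.HodgeTheaters Summit.ABC.IUTFork.Repair.RH.ReachLedger
open Literature.NumberTheory.NumberFields NumberField IsDedekindDomain Metric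

section Genuine

variable {F K Fbar : Type} [Field F] [NumberField F] [Field K] [NumberField K] [Algebra F K] [Field Fbar]
  [Algebra F Fbar] [Algebra K Fbar] {E : WeierstrassCurve F} [E.IsElliptic] {l : ℕ} {Pb : BadPlacePredicates K}
  (D : InitialThetaData F K Fbar E l Pb) {logv : PadicLogs K} (hlog : LogvAnalytic logv)
  (M : Type) [Field M] [NumberField M]
  (archPk : ∀ (j : (thetaIndex (pilotDataOfK D K)).Label) (vQ : (thetaIndex (pilotDataOfK D K)).VQ),
    Set ((logShellsDH (pilotDataOfK D K) logv).Packet j vQ))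
  (archSub : ∀ (j : (thetaIndex (pilotDataOfK D K)).Label) (v : (thetaIndex (pilotDataOfK D K)).V),
    Set ((logShellsDH (pilotDataOfK D K) logv).Packet j ((thetaIndex (pilotDataOfK D K)).over v)))
  (Ψ : ℤ → ∀ v : (thetaIndex (pilotDataOfK D K)).V, v ∈ (thetaIndex (pilotDataOfK D K)).Vbad →
    Set ((logShellsDH (pilotDataOfK D K) logv).StarPacket v))
  (act : ℤ → ∀ v : (thetaIndex (pilotDataOfK D K)).V, v ∈ (thetaIndex (pilotDataOfK D K)).Vbad →
    (logShellsDH (pilotDataOfK D K) logv).StarPacket v → Module.End ℚ ((logShellsDH (pilotDataOfK D K) logv).StarPacket v))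
  (Mmod : ℤ → ∀ j : (thetaIndex (pilotDataOfK D K)).LabelStar, Set ((logShellsDH (pilotDataOfK D K) logv).GlobalPacket j.1))
  (region : ℤ → ∀ j : (thetaIndex (pilotDataOfK D K)).LabelStar, FinDivisor M → ∀ vQ : (thetaIndex (pilotDataOfK D K)).VQ,
    Set ((logShellsDH (pilotDataOfK D K) logv).Packet j.1 vQ))
  (n : ℤ) {HT : Type} {LogLink : HT → HT → Type} {IsFull : ∀ {s t : HT}, LogLink s t → Prop}
  (lat : LGPGaussianLogThetaLattice LogLink IsFull)
  {Frd : Type} {IsoF : Frd → Frd → Type} {Ob : Frd → Type} {realify : Frd → Frd} {Strip : Type}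
  {IsoS : Strip → Strip → Type}
  {Mv : ∀ v : (thetaIndex (pilotDataOfK D K)).V, v ∈ (thetaIndex (pilotDataOfK D K)).Vbad → Type} [∀ v h, Monoid (Mv v h)]
  (sig : GlobalLGPFrobenioidSignature (thetaIndex (pilotDataOfK D K)).lstar (thetaIndex (pilotDataOfK D K)).V
    (· ∈ (thetaIndex (pilotDataOfK D K)).Vbad) Frd IsoF Ob realify Strip IsoS Mv)
  (split : SplittingMonoids Mv) {ObΔ : Type}
  {N : ∀ v : (thetaIndex (pilotDataOfK D K)).V, v ∈ (thetaIndex (pilotDataOfK D K)).Vbad → Type} [∀ v h, Monoid (N v h)]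
  (qData : QPilotData ObΔ N)
  (tq : ∀ (pp : Nat.Primes) (x : (thetaIndex (pilotDataOfK D K)).Fibre (.inr pp)),
    haveI : Fact (pp : ℕ).Prime := ⟨pp.2⟩; kOf (pilotDataOfK D K) pp.1 x)
  (t : ∀ (pp : Nat.Primes) (_ : Fin (pilotDataOfK D K).lstar) (x : (thetaIndex (pilotDataOfK D K)).Fibre (.inr pp)),
    haveI : Fact (pp : ℕ).Prime := ⟨pp.2⟩; kOf (pilotDataOfK D K) pp.1 x)
  (htq0 : ∀ pp x, tq pp x ≠ 0)
  (htq1 : ∀ (pp : Nat.Primes) (x : (thetaIndex (pilotDataOfK D K)).Fibre (.inr pp)),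
    haveI : Fact (pp : ℕ).Prime := ⟨pp.2⟩; placeOf (pilotDataOfK D K) pp.1 x ∉ (pilotDataOfK D K).S → ‖tq pp x‖ = 1)
  (ht0 : ∀ pp i x, t pp i x ≠ 0)
  (ht1 : ∀ (pp : Nat.Primes) (i : Fin (pilotDataOfK D K).lstar) (x : (thetaIndex (pilotDataOfK D K)).Fibre (.inr pp)),
    haveI : Fact (pp : ℕ).Prime := ⟨pp.2⟩; placeOf (pilotDataOfK D K) pp.1 x ∉ (pilotDataOfK D K).S → ‖t pp i x‖ = 1)
  (ht : ∀ (pp : Nat.Primes) (i : Fin (pilotDataOfK D K).lstar) (x : (thetaIndex (pilotDataOfK D K)).Fibre (.inr pp)),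
    haveI : Fact (pp : ℕ).Prime := ⟨pp.2⟩
    Real.log ‖t pp i x‖ = -((pilotDataOfK D K).thetaPilot i (placeOf (pilotDataOfK D K) pp.1 x)) *
      logNorm K (placeOf (pilotDataOfK D K) pp.1 x) / localDegree K (placeOf (pilotDataOfK D K) pp.1 x))
  (htq : ∀ (pp : Nat.Primes) (x : (thetaIndex (pilotDataOfK D K)).Fibre (.inr pp)),
    haveI : Fact (pp : ℕ).Prime := ⟨pp.2⟩
    Real.log ‖tq pp x‖ = -((pilotDataOfK D K).qPilot (placeOf (pilotDataOfK D K) pp.1 x)) *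
      logNorm K (placeOf (pilotDataOfK D K) pp.1 x) / localDegree K (placeOf (pilotDataOfK D K) pp.1 x))
  (eK AK : Nat.Primes → ℕ) (BK : Nat.Primes → ℤ)
  (mq : ∀ pp : Nat.Primes, (thetaIndex (pilotDataOfK D K)).Fibre (.inr pp) → ℤ)

include ht0 ht1 ht htq in
/-- **THE ROW-27 DOOR AT THE GENUINE BED, REALISING IDELES — `HStarReachLedgerK ⟹ Statement`** with the setting's binders DISCHARGED
(`BridgeHyps` by abc-iut-c312-7's `bridgeHyps_settingPrVolSharp_of_ideles`; `hϖ` by `RH2SigmaHull.exists_normUniformizers`; `hΘ`/`hq` by the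
realising profile `mΘ = (i+1)²·m_q`, `RH2SigmaHull.norm_{theta,q}Idele_eq_zpow_of_realises`). Left as HYPOTHESES, each a printed or tabulated
quantity: UNIFORM fibres `e(𝔭_x ∣ p) = e_p ≥ 1` (`K/ℚ` Galois rows), the INNER certificate at `A_p` and the OUTER certificate at `B_p` dominating
the ledger's columns `innerCond p e_p ≤ A_p`, `B_p ≤ rOutSharp p e_p`, the integer Kummer orders `m_q(w) = P_q(w)` at the bad places, and row 27's
candidate `HStarReachLedgerK D e m_q` at the intrinsic index. Conclusion: the typed [IUTchIII] Cor. 3.12 `Statement` of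
`settingPrVolSharp (pilotDataOfK D K) … tq t …` (any columns, any context data). The door p475842 with (α) p475227 (pooled level weights) inside.
[cite: DupuyHilado2025, §3.3, §3.4, §3.9, §4.9] [cite: NeukirchANT1999, Ch. II Prop. (6.8)] [cite: Mochizuki2012, IUTchI Ex. 3.2 (iv) p. 71;
IUTchIII Cor. 3.12 p. 173–174] [claim: Mochizuki2012, status: disputed] -/
theorem statement_pilotDataOfK_of_hStarReachLedgerK (he : ∀ pp, 1 ≤ eK pp)
    (heK : ∀ (pp : Nat.Primes) (x : (thetaIndex (pilotDataOfK D K)).Fibre (.inr pp)), haveI : Fact (pp : ℕ).Prime := ⟨pp.2⟩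
      (placeOf (pilotDataOfK D K) pp.1 x).asIdeal.ramificationIdx ℤ = eK pp)
    (hn₀ : ∀ (pp : Nat.Primes) (x : (thetaIndex (pilotDataOfK D K)).Fibre (.inr pp)), haveI : Fact (pp : ℕ).Prime := ⟨pp.2⟩
      ∃ u : kOf (pilotDataOfK D K) pp.1 x,
        ‖u‖ ≤ (pp : ℝ) ^ (-(((AK pp : ℤ) - 1 : ℤ) : ℝ) / (eK pp : ℝ)) ∧
          u ∉ (logUnits (kOf (pilotDataOfK D K) pp.1 x) : Set (kOf (pilotDataOfK D K) pp.1 x)))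
    (hlam : ∀ (pp : Nat.Primes) (x : (thetaIndex (pilotDataOfK D K)).Fibre (.inr pp)), haveI : Fact (pp : ℕ).Prime := ⟨pp.2⟩
      ∃ z ∈ (logUnits (kOf (pilotDataOfK D K) pp.1 x) : Set (kOf (pilotDataOfK D K) pp.1 x)),
        ((pp : ℕ) : ℝ) ^ (-(BK pp : ℝ) / (eK pp : ℝ)) ≤ ‖z‖)
    (hA : ∀ pp : Nat.Primes, innerCond pp (eK pp) ≤ (AK pp : ℤ)) (hB : ∀ pp : Nat.Primes, BK pp ≤ rOutSharp pp (eK pp))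
    (hmq : ∀ (pp : Nat.Primes) (w : (thetaIndex (pilotDataOfK D K)).Fibre (.inr pp)), haveI : Fact (pp : ℕ).Prime := ⟨pp.2⟩
      placeOf (pilotDataOfK D K) pp.1 w ∈ (pilotDataOfK D K).S →
        (mq pp w : ℝ) = (pilotDataOfK D K).qPilot (placeOf (pilotDataOfK D K) pp.1 w))
    (hH : HStarReachLedgerK D
      (fun pp x => haveI : Fact (pp : ℕ).Prime := ⟨pp.2⟩; (placeOf (pilotDataOfK D K) pp.1 x).asIdeal.ramificationIdx ℤ) mq) :
    (settingPrVolSharp (pilotDataOfK D K) hlog M archPk archSub Ψ act Mmod region n lat sig split qData tq t htq0 htq1).Statement := by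
  haveI hne : ∀ pp : Nat.Primes, Fact (pp : ℕ).Prime := fun pp => ⟨pp.2⟩
  obtain ⟨ϖ, hϖ⟩ := RH2SigmaHull.exists_normUniformizers D
  -- the norm uniformizers in the uniform index `e_p`
  have hramIdx : ∀ (pp : Nat.Primes) (x : (thetaIndex (pilotDataOfK D K)).Fibre (.inr pp)),
      ramIdx K (placeOf (pilotDataOfK D K) pp.1 x) = eK pp := fun pp x => by rw [ramIdx_eq]; exact heK pp x
  have hϖ' : ∀ (pp : Nat.Primes) (x : (thetaIndex (pilotDataOfK D K)).Fibre (.inr pp)),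
      ‖ϖ pp x‖ = ((pp : ℕ) : ℝ) ^ (-(1 : ℝ) / (eK pp : ℝ)) := fun pp x => by rw [hϖ pp x, hramIdx pp x]
  refine statement_of_hStarReachLedger (pilotDataOfK D K) hlog M archPk archSub Ψ act Mmod region n lat sig split qData tq t htq0 htq1
    eK AK BK ϖ (fun pp i w => ((((i : ℕ) : ℤ) + 1) ^ 2) * mq pp w) mq ht0 he hϖ' (fun pp x => ?_) hlam ht1
    (fun pp i w hw => RH2SigmaHull.norm_thetaIdele_eq_zpow_of_realises D tq t htq0 ht0 ht htq mq pp i w (ϖ pp w) (hϖ pp w) (hmq pp w hw))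
    (fun pp w hw => RH2SigmaHull.norm_qIdele_eq_zpow_of_realises D tq htq0 htq mq pp w (ϖ pp w) (hϖ pp w) (hmq pp w hw))
    (fun pp x => (placeOf (pilotDataOfK D K) pp.1 x).asIdeal.ramificationIdx ℤ) heK hA hB (fun pp i w _ => rfl) hH
    (bridgeHyps_settingPrVolSharp_of_ideles (pilotDataOfK D K) hlog M archPk archSub Ψ act Mmod region n lat sig split qData t tq ht0 ht1
      htq0 htq1)
  -- `hsharp`: the inner certificate through `‖ϖ_x‖^{A_p − 1} = p^{−(A_p−1)/e_p}`
  obtain ⟨u, hu, hu'⟩ := hn₀ pp x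
  refine ⟨u, ?_, hu'⟩
  rw [RH2SigmaHull.zpow_of_norm_eq_rpow pp.2.pos (hϖ' pp x)]
  exact hu

end Genuine

/-! ## §2. (APPENDED) Column domination demanded ONLY AT THE BAD PLACES

In `statement_of_hStarReachLedger` (`Repair/RHReachLedgerDoor.lean`) the domination of the ledger's columns by the certificates
(`innerCond p e_p ≤ A_p`, `B_p ≤ rOutSharp p e_p`) is a binder at EVERY prime; it is CONSUMED only at the bad places (the ledger has no cell
elsewhere). The refined doors below ask for it at the bad places only, plus `B_p ≤ A_p` everywhere (always certifiable with the true inner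
conductor and outer order of `log_p(𝒪_x^×)`: `r_out ≤ r_in` since `𝔪^{r_in} ⊆ log_p(𝒪^×)`), so that good primes — tie primes included — carry no
column condition. Same proofs. -/

section BadColumns

variable {F : Type} [Field F] [NumberField F] (X : PilotData F) {logv : PadicLogs F} (hlog : LogvAnalytic logv)
  (M : Type) [Field M] [NumberField M]
  (archPk : ∀ (j : (thetaIndex X).Label) (vQ : (thetaIndex X).VQ), Set ((logShellsDH X logv).Packet j vQ))
  (archSub : ∀ (j : (thetaIndex X).Label) (v : (thetaIndex X).V),
    Set ((logShellsDH X logv).Packet j ((thetaIndex X).over v)))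
  (Ψ : ℤ → ∀ v : (thetaIndex X).V, v ∈ (thetaIndex X).Vbad → Set ((logShellsDH X logv).StarPacket v))
  (act : ℤ → ∀ v : (thetaIndex X).V, v ∈ (thetaIndex X).Vbad →
    (logShellsDH X logv).StarPacket v → Module.End ℚ ((logShellsDH X logv).StarPacket v))
  (Mmod : ℤ → ∀ j : (thetaIndex X).LabelStar, Set ((logShellsDH X logv).GlobalPacket j.1))
  (region : ℤ → ∀ j : (thetaIndex X).LabelStar, FinDivisor M → ∀ vQ : (thetaIndex X).VQ,
    Set ((logShellsDH X logv).Packet j.1 vQ))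
  (n : ℤ) {HT : Type} {LogLink : HT → HT → Type} {IsFull : ∀ {s t : HT}, LogLink s t → Prop}
  (lat : LGPGaussianLogThetaLattice LogLink IsFull)
  {Frd : Type} {IsoF : Frd → Frd → Type} {Ob : Frd → Type} {realify : Frd → Frd} {Strip : Type}
  {IsoS : Strip → Strip → Type} {Mv : ∀ v : (thetaIndex X).V, v ∈ (thetaIndex X).Vbad → Type}
  [∀ v h, Monoid (Mv v h)]
  (sig : GlobalLGPFrobenioidSignature (thetaIndex X).lstar (thetaIndex X).V (· ∈ (thetaIndex X).Vbad)
    Frd IsoF Ob realify Strip IsoS Mv)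
  (split : SplittingMonoids Mv) {ObΔ : Type} {N : ∀ v : (thetaIndex X).V, v ∈ (thetaIndex X).Vbad → Type}
  [∀ v h, Monoid (N v h)] (qData : QPilotData ObΔ N)
  (tq : ∀ (pp : Nat.Primes) (x : (thetaIndex X).Fibre (.inr pp)), haveI : Fact (pp : ℕ).Prime := ⟨pp.2⟩; kOf X pp.1 x)
  (t : ∀ (pp : Nat.Primes) (_ : Fin X.lstar) (x : (thetaIndex X).Fibre (.inr pp)),
    haveI : Fact (pp : ℕ).Prime := ⟨pp.2⟩; kOf X pp.1 x)
  (htq0 : ∀ pp x, tq pp x ≠ 0)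
  (htq1 : ∀ (pp : Nat.Primes) (x : (thetaIndex X).Fibre (.inr pp)),
    haveI : Fact (pp : ℕ).Prime := ⟨pp.2⟩; placeOf X pp.1 x ∉ X.S → ‖tq pp x‖ = 1)
  (eK AK : Nat.Primes → ℕ) (BK : Nat.Primes → ℤ)
  (ϖ : ∀ (pp : Nat.Primes) (x : (thetaIndex X).Fibre (.inr pp)), haveI : Fact (pp : ℕ).Prime := ⟨pp.2⟩; kOf X pp.1 x)
  (mΘ : ∀ pp : Nat.Primes, Fin (thetaIndex X).lstar → (thetaIndex X).Fibre (.inr pp) → ℤ)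
  (mq : ∀ pp : Nat.Primes, (thetaIndex X).Fibre (.inr pp) → ℤ)

open scoped Classical in
/-- **THE ROW-27 DOOR with column domination AT THE BAD PLACES ONLY.** As `statement_of_hStarReachLedger` (bridge hypotheses; uniform certified
dictionary per prime with `B_p ≤ A_p`; realising Θ-orders; `HStarReachLedger`), but `innerCond p e_p ≤ A_p` and `B_p ≤ rOutSharp p e_p` are asked
only at primes carrying a BAD place `w` (where the ledger has cells). [cite: Mochizuki2012, IUTchI Ex. 3.2 (iv) p. 71; IUTchIII Rmk. 3.9.3 pp. 119–120,
Cor. 3.12 p. 173–174] [cite: DupuyHilado2025, §3.6, §3.9, §4.9] [claim: Mochizuki2012, status: disputed] -/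
theorem statement_of_hStarReachLedger_of_badColumns (ht0 : ∀ pp i x, t pp i x ≠ 0) (he : ∀ pp, 1 ≤ eK pp)
    (hBA : ∀ pp, BK pp ≤ (AK pp : ℤ))
    (hϖ : ∀ (pp : Nat.Primes) (x : (thetaIndex X).Fibre (.inr pp)), haveI : Fact (pp : ℕ).Prime := ⟨pp.2⟩
      ‖ϖ pp x‖ = ((pp : ℕ) : ℝ) ^ (-(1 : ℝ) / (eK pp : ℝ)))
    (hsharp : ∀ (pp : Nat.Primes) (x : (thetaIndex X).Fibre (.inr pp)), haveI : Fact (pp : ℕ).Prime := ⟨pp.2⟩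
      ∃ u : kOf X pp.1 x, ‖u‖ ≤ ‖ϖ pp x‖ ^ ((AK pp : ℤ) - 1) ∧ u ∉ (logUnits (kOf X pp.1 x) : Set (kOf X pp.1 x)))
    (hrad : ∀ (pp : Nat.Primes) (x : (thetaIndex X).Fibre (.inr pp)), haveI : Fact (pp : ℕ).Prime := ⟨pp.2⟩
      ∃ z ∈ (logUnits (kOf X pp.1 x) : Set (kOf X pp.1 x)), ((pp : ℕ) : ℝ) ^ (-(BK pp : ℝ) / (eK pp : ℝ)) ≤ ‖z‖)
    (ht1 : ∀ (pp : Nat.Primes) (i : Fin X.lstar) (x : (thetaIndex X).Fibre (.inr pp)),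
      haveI : Fact (pp : ℕ).Prime := ⟨pp.2⟩; placeOf X pp.1 x ∉ X.S → ‖t pp i x‖ = 1)
    (hΘ : ∀ (pp : Nat.Primes) (i : Fin X.lstar) (w : (thetaIndex X).Fibre (.inr pp)), haveI : Fact (pp : ℕ).Prime := ⟨pp.2⟩
      placeOf X pp.1 w ∈ X.S → ‖t pp i w‖ = ‖ϖ pp w‖ ^ (mΘ pp i w))
    (hq : ∀ (pp : Nat.Primes) (w : (thetaIndex X).Fibre (.inr pp)), haveI : Fact (pp : ℕ).Prime := ⟨pp.2⟩
      placeOf X pp.1 w ∈ X.S → ‖tq pp w‖ = ‖ϖ pp w‖ ^ (mq pp w))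
    (eL : ∀ pp : Nat.Primes, (thetaIndex X).Fibre (.inr pp) → ℕ) (heL : ∀ pp x, eL pp x = eK pp)
    (hA : ∀ (pp : Nat.Primes) (w : (thetaIndex X).Fibre (.inr pp)), haveI : Fact (pp : ℕ).Prime := ⟨pp.2⟩
      placeOf X pp.1 w ∈ X.S → innerCond pp (eK pp) ≤ (AK pp : ℤ))
    (hB : ∀ (pp : Nat.Primes) (w : (thetaIndex X).Fibre (.inr pp)), haveI : Fact (pp : ℕ).Prime := ⟨pp.2⟩
      placeOf X pp.1 w ∈ X.S → BK pp ≤ rOutSharp pp (eK pp))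
    (hmΘ : ∀ (pp : Nat.Primes) (i : Fin (thetaIndex X).lstar) (w : (thetaIndex X).Fibre (.inr pp)),
      haveI : Fact (pp : ℕ).Prime := ⟨pp.2⟩; placeOf X pp.1 w ∈ X.S → mΘ pp i w = (((i : ℕ) : ℤ) + 1) ^ 2 * mq pp w)
    (hH : HStarReachLedger (thetaIndex X).lstar (fun pp => (thetaIndex X).Fibre (.inr pp))
      (fun pp w => haveI : Fact (pp : ℕ).Prime := ⟨pp.2⟩; placeOf X pp.1 w ∈ X.S) eL mq)
    (HB : BridgeHyps (settingPrVolSharp X hlog M archPk archSub Ψ act Mmod region n lat sig split qData tq t htq0 htq1)) :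
    (settingPrVolSharp X hlog M archPk archSub Ψ act Mmod region n lat sig split qData tq t htq0 htq1).Statement :=
  statement_of_placeLedger X hlog M archPk archSub Ψ act Mmod region n lat sig split qData tq t htq0 htq1 eK AK BK ϖ mΘ mq
    (fun pp i x => haveI : Fact (pp : ℕ).Prime := ⟨pp.2⟩
      if placeOf X pp.1 x ∈ X.S then cellReachSlack pp (eK pp) ((i : ℕ) + 1) (mq pp x) else 0)
    ht0 he hBA hϖ hsharp hrad ht1 hΘ hq
    (fun pp i x hx => if_neg hx)
    (fun pp i w hw => by
      have h := cellReachSlack_succ_le_realised pp (eK pp) (he pp) (AK pp) (BK pp) i (mq pp w) (hA pp w hw) (hB pp w hw)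
      rw [if_pos hw, hmΘ pp i w hw]
      linarith [h])
    (fun pp w hw => by
      have hcell : LedgerCell (thetaIndex X).lstar pp (eK pp) (mq pp w) := by rw [← heL pp w]; exact hH pp w hw
      have h := sum_cellReachSlack_nonneg_of_ledgerCell (he pp) hcell
      simpa only [if_pos hw] using h)
    HB

end BadColumns

section GenuineBadColumns

variable {F K Fbar : Type} [Field F] [NumberField F] [Field K] [NumberField K] [Algebra F K] [Field Fbar]
  [Algebra F Fbar] [Algebra K Fbar] {E : WeierstrassCurve F} [E.IsElliptic] {l : ℕ} {Pb : BadPlacePredicates K}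
  (D : InitialThetaData F K Fbar E l Pb) {logv : PadicLogs K} (hlog : LogvAnalytic logv)
  (M : Type) [Field M] [NumberField M]
  (archPk : ∀ (j : (thetaIndex (pilotDataOfK D K)).Label) (vQ : (thetaIndex (pilotDataOfK D K)).VQ),
    Set ((logShellsDH (pilotDataOfK D K) logv).Packet j vQ))
  (archSub : ∀ (j : (thetaIndex (pilotDataOfK D K)).Label) (v : (thetaIndex (pilotDataOfK D K)).V),
    Set ((logShellsDH (pilotDataOfK D K) logv).Packet j ((thetaIndex (pilotDataOfK D K)).over v)))
  (Ψ : ℤ → ∀ v : (thetaIndex (pilotDataOfK D K)).V, v ∈ (thetaIndex (pilotDataOfK D K)).Vbad →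
    Set ((logShellsDH (pilotDataOfK D K) logv).StarPacket v))
  (act : ℤ → ∀ v : (thetaIndex (pilotDataOfK D K)).V, v ∈ (thetaIndex (pilotDataOfK D K)).Vbad →
    (logShellsDH (pilotDataOfK D K) logv).StarPacket v → Module.End ℚ ((logShellsDH (pilotDataOfK D K) logv).StarPacket v))
  (Mmod : ℤ → ∀ j : (thetaIndex (pilotDataOfK D K)).LabelStar, Set ((logShellsDH (pilotDataOfK D K) logv).GlobalPacket j.1))
  (region : ℤ → ∀ j : (thetaIndex (pilotDataOfK D K)).LabelStar, FinDivisor M → ∀ vQ : (thetaIndex (pilotDataOfK D K)).VQ,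
    Set ((logShellsDH (pilotDataOfK D K) logv).Packet j.1 vQ))
  (n : ℤ) {HT : Type} {LogLink : HT → HT → Type} {IsFull : ∀ {s t : HT}, LogLink s t → Prop}
  (lat : LGPGaussianLogThetaLattice LogLink IsFull)
  {Frd : Type} {IsoF : Frd → Frd → Type} {Ob : Frd → Type} {realify : Frd → Frd} {Strip : Type}
  {IsoS : Strip → Strip → Type}
  {Mv : ∀ v : (thetaIndex (pilotDataOfK D K)).V, v ∈ (thetaIndex (pilotDataOfK D K)).Vbad → Type} [∀ v h, Monoid (Mv v h)]
  (sig : GlobalLGPFrobenioidSignature (thetaIndex (pilotDataOfK D K)).lstar (thetaIndex (pilotDataOfK D K)).V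
    (· ∈ (thetaIndex (pilotDataOfK D K)).Vbad) Frd IsoF Ob realify Strip IsoS Mv)
  (split : SplittingMonoids Mv) {ObΔ : Type}
  {N : ∀ v : (thetaIndex (pilotDataOfK D K)).V, v ∈ (thetaIndex (pilotDataOfK D K)).Vbad → Type} [∀ v h, Monoid (N v h)]
  (qData : QPilotData ObΔ N)
  (tq : ∀ (pp : Nat.Primes) (x : (thetaIndex (pilotDataOfK D K)).Fibre (.inr pp)),
    haveI : Fact (pp : ℕ).Prime := ⟨pp.2⟩; kOf (pilotDataOfK D K) pp.1 x)
  (t : ∀ (pp : Nat.Primes) (_ : Fin (pilotDataOfK D K).lstar) (x : (thetaIndex (pilotDataOfK D K)).Fibre (.inr pp)),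
    haveI : Fact (pp : ℕ).Prime := ⟨pp.2⟩; kOf (pilotDataOfK D K) pp.1 x)
  (htq0 : ∀ pp x, tq pp x ≠ 0)
  (htq1 : ∀ (pp : Nat.Primes) (x : (thetaIndex (pilotDataOfK D K)).Fibre (.inr pp)),
    haveI : Fact (pp : ℕ).Prime := ⟨pp.2⟩; placeOf (pilotDataOfK D K) pp.1 x ∉ (pilotDataOfK D K).S → ‖tq pp x‖ = 1)
  (ht0 : ∀ pp i x, t pp i x ≠ 0)
  (ht1 : ∀ (pp : Nat.Primes) (i : Fin (pilotDataOfK D K).lstar) (x : (thetaIndex (pilotDataOfK D K)).Fibre (.inr pp)),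
    haveI : Fact (pp : ℕ).Prime := ⟨pp.2⟩; placeOf (pilotDataOfK D K) pp.1 x ∉ (pilotDataOfK D K).S → ‖t pp i x‖ = 1)
  (ht : ∀ (pp : Nat.Primes) (i : Fin (pilotDataOfK D K).lstar) (x : (thetaIndex (pilotDataOfK D K)).Fibre (.inr pp)),
    haveI : Fact (pp : ℕ).Prime := ⟨pp.2⟩
    Real.log ‖t pp i x‖ = -((pilotDataOfK D K).thetaPilot i (placeOf (pilotDataOfK D K) pp.1 x)) *
      logNorm K (placeOf (pilotDataOfK D K) pp.1 x) / localDegree K (placeOf (pilotDataOfK D K) pp.1 x))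
  (htq : ∀ (pp : Nat.Primes) (x : (thetaIndex (pilotDataOfK D K)).Fibre (.inr pp)),
    haveI : Fact (pp : ℕ).Prime := ⟨pp.2⟩
    Real.log ‖tq pp x‖ = -((pilotDataOfK D K).qPilot (placeOf (pilotDataOfK D K) pp.1 x)) *
      logNorm K (placeOf (pilotDataOfK D K) pp.1 x) / localDegree K (placeOf (pilotDataOfK D K) pp.1 x))
  (eK AK : Nat.Primes → ℕ) (BK : Nat.Primes → ℤ)
  (mq : ∀ pp : Nat.Primes, (thetaIndex (pilotDataOfK D K)).Fibre (.inr pp) → ℤ)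

include ht0 ht1 ht htq in
/-- **THE ROW-27 DOOR AT THE GENUINE BED, column domination AT THE BAD PLACES ONLY.** As `statement_pilotDataOfK_of_hStarReachLedgerK`, with
`innerCond p e_p ≤ A_p`, `B_p ≤ rOutSharp p e_p` asked only at the bad places and `B_p ≤ A_p` everywhere (certifiable at every place by the true inner
conductor / outer order). The residual binders of row 27 at a `K/ℚ`-Galois datum are thus: the two certificates AT THE BAD PRIMES at the ledger's
column values (off the inner/outer ties of those primes), the integer Kummer orders, and the ledger. [cite: DupuyHilado2025, §3.3, §3.4, §3.9, §4.9]
[cite: Mochizuki2012, IUTchI Ex. 3.2 (iv) p. 71; IUTchIII Cor. 3.12 p. 173–174] [claim: Mochizuki2012, status: disputed] -/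
theorem statement_pilotDataOfK_of_hStarReachLedgerK_of_badColumns (he : ∀ pp, 1 ≤ eK pp) (hBA : ∀ pp, BK pp ≤ (AK pp : ℤ))
    (heK : ∀ (pp : Nat.Primes) (x : (thetaIndex (pilotDataOfK D K)).Fibre (.inr pp)), haveI : Fact (pp : ℕ).Prime := ⟨pp.2⟩
      (placeOf (pilotDataOfK D K) pp.1 x).asIdeal.ramificationIdx ℤ = eK pp)
    (hn₀ : ∀ (pp : Nat.Primes) (x : (thetaIndex (pilotDataOfK D K)).Fibre (.inr pp)), haveI : Fact (pp : ℕ).Prime := ⟨pp.2⟩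
      ∃ u : kOf (pilotDataOfK D K) pp.1 x,
        ‖u‖ ≤ (pp : ℝ) ^ (-(((AK pp : ℤ) - 1 : ℤ) : ℝ) / (eK pp : ℝ)) ∧
          u ∉ (logUnits (kOf (pilotDataOfK D K) pp.1 x) : Set (kOf (pilotDataOfK D K) pp.1 x)))
    (hlam : ∀ (pp : Nat.Primes) (x : (thetaIndex (pilotDataOfK D K)).Fibre (.inr pp)), haveI : Fact (pp : ℕ).Prime := ⟨pp.2⟩
      ∃ z ∈ (logUnits (kOf (pilotDataOfK D K) pp.1 x) : Set (kOf (pilotDataOfK D K) pp.1 x)),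
        ((pp : ℕ) : ℝ) ^ (-(BK pp : ℝ) / (eK pp : ℝ)) ≤ ‖z‖)
    (hA : ∀ (pp : Nat.Primes) (w : (thetaIndex (pilotDataOfK D K)).Fibre (.inr pp)), haveI : Fact (pp : ℕ).Prime := ⟨pp.2⟩
      placeOf (pilotDataOfK D K) pp.1 w ∈ (pilotDataOfK D K).S → innerCond pp (eK pp) ≤ (AK pp : ℤ))
    (hB : ∀ (pp : Nat.Primes) (w : (thetaIndex (pilotDataOfK D K)).Fibre (.inr pp)), haveI : Fact (pp : ℕ).Prime := ⟨pp.2⟩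
      placeOf (pilotDataOfK D K) pp.1 w ∈ (pilotDataOfK D K).S → BK pp ≤ rOutSharp pp (eK pp))
    (hmq : ∀ (pp : Nat.Primes) (w : (thetaIndex (pilotDataOfK D K)).Fibre (.inr pp)), haveI : Fact (pp : ℕ).Prime := ⟨pp.2⟩
      placeOf (pilotDataOfK D K) pp.1 w ∈ (pilotDataOfK D K).S →
        (mq pp w : ℝ) = (pilotDataOfK D K).qPilot (placeOf (pilotDataOfK D K) pp.1 w))
    (hH : HStarReachLedgerK D
      (fun pp x => haveI : Fact (pp : ℕ).Prime := ⟨pp.2⟩; (placeOf (pilotDataOfK D K) pp.1 x).asIdeal.ramificationIdx ℤ) mq) :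
    (settingPrVolSharp (pilotDataOfK D K) hlog M archPk archSub Ψ act Mmod region n lat sig split qData tq t htq0 htq1).Statement := by
  haveI hne : ∀ pp : Nat.Primes, Fact (pp : ℕ).Prime := fun pp => ⟨pp.2⟩
  obtain ⟨ϖ, hϖ⟩ := RH2SigmaHull.exists_normUniformizers D
  have hramIdx : ∀ (pp : Nat.Primes) (x : (thetaIndex (pilotDataOfK D K)).Fibre (.inr pp)),
      ramIdx K (placeOf (pilotDataOfK D K) pp.1 x) = eK pp := fun pp x => by rw [ramIdx_eq]; exact heK pp x
  have hϖ' : ∀ (pp : Nat.Primes) (x : (thetaIndex (pilotDataOfK D K)).Fibre (.inr pp)),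
      ‖ϖ pp x‖ = ((pp : ℕ) : ℝ) ^ (-(1 : ℝ) / (eK pp : ℝ)) := fun pp x => by rw [hϖ pp x, hramIdx pp x]
  refine statement_of_hStarReachLedger_of_badColumns (pilotDataOfK D K) hlog M archPk archSub Ψ act Mmod region n lat sig split qData tq t
    htq0 htq1 eK AK BK ϖ (fun pp i w => ((((i : ℕ) : ℤ) + 1) ^ 2) * mq pp w) mq ht0 he hBA hϖ' (fun pp x => ?_) hlam ht1
    (fun pp i w hw => RH2SigmaHull.norm_thetaIdele_eq_zpow_of_realises D tq t htq0 ht0 ht htq mq pp i w (ϖ pp w) (hϖ pp w) (hmq pp w hw))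
    (fun pp w hw => RH2SigmaHull.norm_qIdele_eq_zpow_of_realises D tq htq0 htq mq pp w (ϖ pp w) (hϖ pp w) (hmq pp w hw))
    (fun pp x => (placeOf (pilotDataOfK D K) pp.1 x).asIdeal.ramificationIdx ℤ) heK hA hB (fun pp i w _ => rfl) hH
    (bridgeHyps_settingPrVolSharp_of_ideles (pilotDataOfK D K) hlog M archPk archSub Ψ act Mmod region n lat sig split qData t tq ht0 ht1
      htq0 htq1)
  obtain ⟨u, hu, hu'⟩ := hn₀ pp x
  refine ⟨u, ?_, hu'⟩
  rw [RH2SigmaHull.zpow_of_norm_eq_rpow pp.2.pos (hϖ' pp x)]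
  exact hu

end GenuineBadColumns

end Summit.ABC.IUTFork.Repair.RH.ReachLedgerDoor

end
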